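import Mathlib
import Literature.NumberTheory.Automorphic.HilbertModularFormQExpansion
import Summits.Langlands.Langlands.Theorems.CapacityClassicalityHilbertIntegralOverconvergentIsCongruenceStubFiniteQIndexAntidiagonal
import Summits.Langlands.Langlands.Theorems.CapacityClassicalityHilbertIntegralOverconvergentIsCongruenceStubThetaDualProps

/-!
# `E`-rational integral data of the scaled Rankin–Cohen bracket (stub `stub_bracket_Edata` of line Sketch-ideate-r1-k1)

Section X of line Sketch-ideate-r1-k1 of the crux `HilbertIntegralOverconvergentIsCongruence`
(stmt-Langlands-8485) produces Hilbert modular forms of non-parallel weight from Rankin–Cohen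
brackets `[f,g]_σ = k_σ f ∂_σ g - l_σ g ∂_σ f`.  If `f, g` have integer Fourier coefficients
`zf, zg` on the cone, the coefficients of `G = (2πi)⁻¹ d_F [f,g]_σ` are
`a_ν(G) = ∑_{μ + μ' = ν} σ(d_F μ') (k_σ zf_μ zg_μ' - l_σ zg_μ zf_μ')`.  This file proves the
registered stub `stub_bracket_Edata`: these coefficients are the images under `τ` of the
`E`-valued function `qG ν = ι(x_ν)`, `x_ν = ∑_{μ + μ' = ν} (d_F μ') (k_σ zf_μ zg_μ' - l_σ zg_μ zf_μ')`,
where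

* `x_ν ∈ 𝓞 F` because `d_F 𝔡⁻¹ ⊆ 𝓞 F` (`tdp_mul_discr_mem`), so `qG` is `𝓞_E`-integral;
* for every embedding `τ'` of `E`, `ρ = τ' ∘ ι` is a real embedding of the totally real field `F`,
  `|ρ(d_F μ')| ≤ |d_F| ρ(ν)` for cone pairs `μ + μ' = ν`, and the polynomial weight is absorbed by
  halving the height, `ρ(ν) e^{-2π⟨ν,y⟩} ≤ (π y_ρ)⁻¹ e^{-2π⟨ν,y/2⟩}`; hence the `q`-series of
  `τ' ∘ qG` is dominated on the tube by a constant multiple of the given majorant (the tube-summable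
  cone convolution of `|zf|` and `|zg|`) at half the height.
-/

set_option linter.dupNamespace false

noncomputable section

namespace Summit.Langlands.Langlands.Theorems.HilbertIntegralOverconvergentIsCongruence

open MeasureTheory Complex NumberField
open Literature.NumberTheory.Automorphic Literature.NumberTheory.Automorphic.HilbertModular
open scoped MatrixGroups

/-- Integers are integral over `ℤ` in any ring. [folklore] -/
theorem bed_isIntegral_intCast (R : Type*) [Ring R] (n : ℤ) : IsIntegral ℤ (n : R) := by
  rw [← eq_intCast (algebraMap ℤ R) n]
  exact isIntegral_algebraMap

/-- Each bracket term is an algebraic integer: `d_F μ' ∈ 𝓞 F` for `μ'` in the cone (`⊆ 𝔡⁻¹`,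
`d_F 𝔡⁻¹ ⊆ 𝓞 F` by `tdp_mul_discr_mem`), and the other factors are integers. [folklore] -/
theorem bed_term_isIntegral (F : Type) [Field F] [NumberField F] (kσ lσ : ℤ) (zf zg : F → ℤ)
    {μ : F × F} (hμ2 : μ.2 ∈ qIndexSet F) :
    IsIntegral ℤ (((NumberField.discr F : F) * μ.2) *
      ((kσ : F) * (zf μ.1 : F) * (zg μ.2 : F) - (lσ : F) * (zg μ.1 : F) * (zf μ.2 : F))) := by
  obtain ⟨a, ha⟩ := tdp_mul_discr_mem hμ2.1
  have hd : IsIntegral ℤ ((NumberField.discr F : F) * μ.2) := by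
    rw [mul_comm, ← ha]
    exact RingOfIntegers.isIntegral_coe a
  refine hd.mul (IsIntegral.sub ?_ ?_) <;>
    exact ((bed_isIntegral_intCast F _).mul (bed_isIntegral_intCast F _)).mul
      (bed_isIntegral_intCast F _)

/-- `t e^{-a t} ≤ a⁻¹` for real `t` and `a > 0` (from `1 + s ≤ e^s`). [folklore] -/
theorem bed_mul_exp_neg_le {a : ℝ} (t : ℝ) (ha : 0 < a) :
    t * Real.exp (-(a * t)) ≤ a⁻¹ := by
  have h1 : a * t + 1 ≤ Real.exp (a * t) := Real.add_one_le_exp _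
  have h2 : a * t ≤ Real.exp (a * t) := by linarith
  have h3 : Real.exp (a * t) * Real.exp (-(a * t)) = 1 := by
    rw [← Real.exp_add, add_neg_cancel, Real.exp_zero]
  have h4 : t * Real.exp (-(a * t)) = a⁻¹ * (a * t * Real.exp (-(a * t))) := by
    field_simp
  calc t * Real.exp (-(a * t)) = a⁻¹ * (a * t * Real.exp (-(a * t))) := h4
    _ ≤ a⁻¹ * (Real.exp (a * t) * Real.exp (-(a * t))) :=
        mul_le_mul_of_nonneg_left (mul_le_mul_of_nonneg_right h2 (Real.exp_pos _).le)
          (inv_pos.2 ha).le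
    _ = a⁻¹ := by rw [h3, mul_one]

/-- Polynomial weights are absorbed by halving the height: for `ν` totally non-negative, `y ≫ 0`
and a real embedding `ρ`, `ρ(ν) e^{-2π⟨ν,y⟩} ≤ (π y_ρ)⁻¹ e^{-2π⟨ν,y/2⟩}` (`⟨ν,y⟩ ≥ ρ(ν) y_ρ` and
`t e^{-π y_ρ t} ≤ (π y_ρ)⁻¹`). [folklore] -/
theorem bed_weight_exp_le {F : Type} [Field F] [NumberField F] (ρ : F →+* ℝ) {ν : F}
    (hν : ∀ σ' : F →+* ℝ, 0 ≤ σ' ν) (y : (F →+* ℝ) → ℝ) (hy : ∀ σ', 0 < y σ') :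
    ρ ν * Real.exp (-(2 * Real.pi * ∑ σ' : F →+* ℝ, σ' ν * y σ')) ≤
      (Real.pi * y ρ)⁻¹ * Real.exp (-(2 * Real.pi * ∑ σ' : F →+* ℝ, σ' ν * (y σ' / 2))) := by
  set P : ℝ := ∑ σ' : F →+* ℝ, σ' ν * y σ' with hP
  have hhalf : ∑ σ' : F →+* ℝ, σ' ν * (y σ' / 2) = P / 2 := by
    rw [hP, Finset.sum_div]
    exact Finset.sum_congr rfl fun σ' _ ↦ by ring
  have hρP : ρ ν * y ρ ≤ P :=
    Finset.single_le_sum (f := fun σ' : F →+* ℝ ↦ σ' ν * y σ')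
      (fun σ' _ ↦ mul_nonneg (hν σ') (hy σ').le) (Finset.mem_univ ρ)
  have hsplit : Real.exp (-(2 * Real.pi * P)) =
      Real.exp (-(Real.pi * P)) * Real.exp (-(2 * Real.pi * (P / 2))) := by
    rw [← Real.exp_add]
    congr 1
    ring
  rw [hhalf, hsplit, ← mul_assoc]
  refine mul_le_mul_of_nonneg_right ?_ (Real.exp_pos _).le
  calc ρ ν * Real.exp (-(Real.pi * P))
      ≤ ρ ν * Real.exp (-((Real.pi * y ρ) * ρ ν)) := by
        refine mul_le_mul_of_nonneg_left (Real.exp_le_exp.2 ?_) (hν ρ)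
        have : Real.pi * (ρ ν * y ρ) ≤ Real.pi * P := mul_le_mul_of_nonneg_left hρP Real.pi_pos.le
        nlinarith [this]
    _ ≤ (Real.pi * y ρ)⁻¹ := bed_mul_exp_neg_le (ρ ν) (mul_pos Real.pi_pos (hy ρ))

/-- Size of one term of the bracket coefficient under a real embedding `ρ`: for a cone pair
`(μ, μ')` with `μ + μ' = ν` one has `0 ≤ ρ(μ') ≤ ρ(ν)`, hence
`|ρ(d_F μ' (k a_μ b_μ' - l b_μ a_μ'))| ≤ |d_F| ρ(ν) (|k| + |l|) (|a_μ| |b_μ'| + |b_μ| |a_μ'|)`. [folklore] -/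
theorem bed_term_abs_le {F : Type} [Field F] [NumberField F] (ρ : F →+* ℝ) {ν : F} {μ : F × F}
    (hμ : μ.1 ∈ qIndexSet F ∧ μ.2 ∈ qIndexSet F ∧ μ.1 + μ.2 = ν) (kσ lσ : ℤ) (zf zg : F → ℤ) :
    |ρ (((NumberField.discr F : F) * μ.2) *
        ((kσ : F) * (zf μ.1 : F) * (zg μ.2 : F) - (lσ : F) * (zg μ.1 : F) * (zf μ.2 : F)))| ≤
      |(NumberField.discr F : ℝ)| * ρ ν * ((|(kσ : ℝ)| + |(lσ : ℝ)|) *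
        (|(zf μ.1 : ℝ)| * |(zg μ.2 : ℝ)| + |(zg μ.1 : ℝ)| * |(zf μ.2 : ℝ)|)) := by
  obtain ⟨h1, h2, h12⟩ := hμ
  have hρ2 : 0 ≤ ρ μ.2 := fqa_nonneg_of_mem_qIndexSet h2 ρ
  have hρ2le : ρ μ.2 ≤ ρ ν := by
    have h1' := fqa_nonneg_of_mem_qIndexSet h1 ρ
    rw [← h12, map_add]
    linarith
  simp only [map_mul, map_sub, map_intCast]
  rw [abs_mul, abs_mul, abs_of_nonneg hρ2]
  have hA : |(kσ : ℝ) * (zf μ.1 : ℝ) * (zg μ.2 : ℝ) - (lσ : ℝ) * (zg μ.1 : ℝ) * (zf μ.2 : ℝ)| ≤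
      (|(kσ : ℝ)| + |(lσ : ℝ)|) *
        (|(zf μ.1 : ℝ)| * |(zg μ.2 : ℝ)| + |(zg μ.1 : ℝ)| * |(zf μ.2 : ℝ)|) := by
    refine (abs_sub _ _).trans ?_
    rw [abs_mul, abs_mul, abs_mul, abs_mul]
    nlinarith [mul_nonneg (mul_nonneg (abs_nonneg (kσ : ℝ)) (abs_nonneg (zg μ.1 : ℝ)))
      (abs_nonneg (zf μ.2 : ℝ)), mul_nonneg (mul_nonneg (abs_nonneg (lσ : ℝ))
      (abs_nonneg (zf μ.1 : ℝ))) (abs_nonneg (zg μ.2 : ℝ))]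
  exact mul_le_mul (mul_le_mul_of_nonneg_left hρ2le (abs_nonneg _)) hA (abs_nonneg _)
    (mul_nonneg (abs_nonneg _) (hρ2.trans hρ2le))

/-- The weighted size of one bracket term: for a cone pair `μ + μ' = ν` and heights `y ≫ 0`,
`|ρ(term)| e^{-2π⟨ν,y⟩} ≤ |d_F| (|k| + |l|) (π y_ρ)⁻¹ · (|a_μ| |b_μ'| + |b_μ| |a_μ'|) e^{-2π⟨ν,y/2⟩}`.
[folklore] -/
theorem bed_term_weighted_le {F : Type} [Field F] [NumberField F] (ρ : F →+* ℝ) {ν : F}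
    {μ : F × F} (hμ : μ.1 ∈ qIndexSet F ∧ μ.2 ∈ qIndexSet F ∧ μ.1 + μ.2 = ν) (kσ lσ : ℤ)
    (zf zg : F → ℤ) (y : (F →+* ℝ) → ℝ) (hy : ∀ σ', 0 < y σ') :
    |ρ (((NumberField.discr F : F) * μ.2) *
        ((kσ : F) * (zf μ.1 : F) * (zg μ.2 : F) - (lσ : F) * (zg μ.1 : F) * (zf μ.2 : F)))| *
        Real.exp (-(2 * Real.pi * ∑ σ' : F →+* ℝ, σ' ν * y σ')) ≤
      |(NumberField.discr F : ℝ)| * (|(kσ : ℝ)| + |(lσ : ℝ)|) * (Real.pi * y ρ)⁻¹ *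
        ((|(zf μ.1 : ℝ)| * |(zg μ.2 : ℝ)| + |(zg μ.1 : ℝ)| * |(zf μ.2 : ℝ)|) *
          Real.exp (-(2 * Real.pi * ∑ σ' : F →+* ℝ, σ' ν * (y σ' / 2)))) := by
  have hν : ∀ σ' : F →+* ℝ, 0 ≤ σ' ν := fun σ' ↦ by
    rw [← hμ.2.2, map_add]
    exact add_nonneg (fqa_nonneg_of_mem_qIndexSet hμ.1 σ') (fqa_nonneg_of_mem_qIndexSet hμ.2.1 σ')
  have hA : 0 ≤ |(zf μ.1 : ℝ)| * |(zg μ.2 : ℝ)| + |(zg μ.1 : ℝ)| * |(zf μ.2 : ℝ)| := by positivity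
  have h1 := bed_term_abs_le ρ hμ kσ lσ zf zg
  have h2 := bed_weight_exp_le ρ hν y hy
  calc |ρ (((NumberField.discr F : F) * μ.2) *
          ((kσ : F) * (zf μ.1 : F) * (zg μ.2 : F) - (lσ : F) * (zg μ.1 : F) * (zf μ.2 : F)))| *
        Real.exp (-(2 * Real.pi * ∑ σ' : F →+* ℝ, σ' ν * y σ'))
      ≤ |(NumberField.discr F : ℝ)| * ρ ν * ((|(kσ : ℝ)| + |(lσ : ℝ)|) *
          (|(zf μ.1 : ℝ)| * |(zg μ.2 : ℝ)| + |(zg μ.1 : ℝ)| * |(zf μ.2 : ℝ)|)) *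
          Real.exp (-(2 * Real.pi * ∑ σ' : F →+* ℝ, σ' ν * y σ')) :=
        mul_le_mul_of_nonneg_right h1 (Real.exp_pos _).le
    _ = |(NumberField.discr F : ℝ)| * (|(kσ : ℝ)| + |(lσ : ℝ)|) *
          (|(zf μ.1 : ℝ)| * |(zg μ.2 : ℝ)| + |(zg μ.1 : ℝ)| * |(zf μ.2 : ℝ)|) *
          (ρ ν * Real.exp (-(2 * Real.pi * ∑ σ' : F →+* ℝ, σ' ν * y σ'))) := by ring
    _ ≤ |(NumberField.discr F : ℝ)| * (|(kσ : ℝ)| + |(lσ : ℝ)|) *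
          (|(zf μ.1 : ℝ)| * |(zg μ.2 : ℝ)| + |(zg μ.1 : ℝ)| * |(zf μ.2 : ℝ)|) *
          ((Real.pi * y ρ)⁻¹ * Real.exp (-(2 * Real.pi * ∑ σ' : F →+* ℝ, σ' ν * (y σ' / 2)))) :=
        mul_le_mul_of_nonneg_left h2 (by positivity)
    _ = _ := by ring

/-- The weighted size of the whole bracket coefficient under a real embedding `ρ`:
`|ρ(x_ν)| e^{-2π⟨ν,y⟩} ≤ C · (∑_{μ+μ'=ν} (|a_μ| |b_μ'| + |b_μ| |a_μ'|)) e^{-2π⟨ν,y/2⟩}` with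
`C = |d_F| (|k| + |l|) (π y_ρ)⁻¹` (triangle inequality and `bed_term_weighted_le` termwise). [folklore] -/
theorem bed_coeff_weighted_le {F : Type} [Field F] [NumberField F] [NumberField.IsTotallyReal F]
    (ρ : F →+* ℝ) (kσ lσ : ℤ) (zf zg : F → ℤ) (y : (F →+* ℝ) → ℝ) (hy : ∀ σ', 0 < y σ') (ν : F) :
    |ρ (∑ μ ∈ (stub_finite_qIndex_antidiagonal F ν).toFinset, ((NumberField.discr F : F) * μ.2) *
        ((kσ : F) * (zf μ.1 : F) * (zg μ.2 : F) - (lσ : F) * (zg μ.1 : F) * (zf μ.2 : F)))| *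
        Real.exp (-(2 * Real.pi * ∑ σ' : F →+* ℝ, σ' ν * y σ')) ≤
      |(NumberField.discr F : ℝ)| * (|(kσ : ℝ)| + |(lσ : ℝ)|) * (Real.pi * y ρ)⁻¹ *
        ((∑ μ ∈ (stub_finite_qIndex_antidiagonal F ν).toFinset,
            (|(zf μ.1 : ℝ)| * |(zg μ.2 : ℝ)| + |(zg μ.1 : ℝ)| * |(zf μ.2 : ℝ)|)) *
          Real.exp (-(2 * Real.pi * ∑ σ' : F →+* ℝ, σ' ν * (y σ' / 2)))) := by
  rw [map_sum]
  calc |∑ μ ∈ (stub_finite_qIndex_antidiagonal F ν).toFinset, ρ (((NumberField.discr F : F) * μ.2) *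
          ((kσ : F) * (zf μ.1 : F) * (zg μ.2 : F) - (lσ : F) * (zg μ.1 : F) * (zf μ.2 : F)))| *
        Real.exp (-(2 * Real.pi * ∑ σ' : F →+* ℝ, σ' ν * y σ'))
      ≤ (∑ μ ∈ (stub_finite_qIndex_antidiagonal F ν).toFinset,
          |ρ (((NumberField.discr F : F) * μ.2) *
            ((kσ : F) * (zf μ.1 : F) * (zg μ.2 : F) - (lσ : F) * (zg μ.1 : F) * (zf μ.2 : F)))|) *
          Real.exp (-(2 * Real.pi * ∑ σ' : F →+* ℝ, σ' ν * y σ')) :=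
        mul_le_mul_of_nonneg_right (Finset.abs_sum_le_sum_abs _ _) (Real.exp_pos _).le
    _ = ∑ μ ∈ (stub_finite_qIndex_antidiagonal F ν).toFinset,
          |ρ (((NumberField.discr F : F) * μ.2) *
            ((kσ : F) * (zf μ.1 : F) * (zg μ.2 : F) - (lσ : F) * (zg μ.1 : F) * (zf μ.2 : F)))| *
          Real.exp (-(2 * Real.pi * ∑ σ' : F →+* ℝ, σ' ν * y σ')) := Finset.sum_mul _ _ _
    _ ≤ ∑ μ ∈ (stub_finite_qIndex_antidiagonal F ν).toFinset,
          |(NumberField.discr F : ℝ)| * (|(kσ : ℝ)| + |(lσ : ℝ)|) * (Real.pi * y ρ)⁻¹ *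
            ((|(zf μ.1 : ℝ)| * |(zg μ.2 : ℝ)| + |(zg μ.1 : ℝ)| * |(zf μ.2 : ℝ)|) *
              Real.exp (-(2 * Real.pi * ∑ σ' : F →+* ℝ, σ' ν * (y σ' / 2)))) :=
        Finset.sum_le_sum fun μ hμ ↦ bed_term_weighted_le ρ
          ((stub_finite_qIndex_antidiagonal F ν).mem_toFinset.1 hμ) kσ lσ zf zg y hy
    _ = _ := by rw [Finset.sum_mul, ← Finset.mul_sum]

/-- **stub X5 — `stub_bracket_Edata` (M; `E`-rational integral data of the scaled bracket).** Let `f, g` be Hilbert modular forms of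
level `Γ₁(𝔫)` with INTEGER coefficients `zf, zg` on the cone, `σ` a place, `ι : F → E` with `τ ∘ ι = σ`, and `G` a function whose
Fourier coefficients on the cone are `a_ν(G) = ∑_{μ+μ'=ν} σ(d_F μ') (k_σ zf_μ zg_μ' - l_σ zg_μ zf_μ')` (the coefficients of
`(2πi)⁻¹ d_F [f,g]_σ`).  Then `a_ν(G) = τ(qG ν)` with `qG ν = ι(x_ν)`, `x_ν = ∑ (d_F μ')(…) ∈ 𝓞F` (`d_F 𝔡⁻¹ ⊆ 𝓞F`), `qG` is
`𝓞_E`-integral, and for every embedding `τ'` of `E` (`τ' ∘ ι` is a real embedding `ρ`, `|ρ(d_F μ')| ≤ d_F ρ(ν)` on cone pairs) the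
`q`-series of `τ' ∘ qG` converges absolutely on the tube (polynomial factor `ρ(ν) e^{-2π⟨ν,y⟩} ≤ C_y e^{-2π⟨ν,y/2⟩}` against the given
majorant `hmaj` — the tube-summable convolution of `|zf|`, `|zg|` — at half the height). [folklore] -/
theorem stub_bracket_Edata (F : Type) [Field F] [NumberField F] [NumberField.IsTotallyReal F]
    (_hd : 1 < Module.finrank ℚ F) (𝔫 : Ideal (𝓞 F)) (_h𝔫 : 𝔫 ≠ ⊥) (E : Type) [Field E] [NumberField E]
    (τ : E →+* ℂ) (ι : F →+* E) (σ : F →+* ℝ) (hι : ∀ x : F, τ (ι x) = ((σ x : ℝ) : ℂ))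
    (k l : (F →+* ℝ) → ℤ) (f g : Point F → ℂ) (_hf : f ∈ modularForms (Bianchi.Gamma1 𝔫) k)
    (_hg : g ∈ modularForms (Bianchi.Gamma1 𝔫) l) (zf zg : F → ℤ)
    (_hzf : ∀ ν ∈ qIndexSet F, fourierCoeff f ν = (zf ν : ℂ)) (_hzg : ∀ ν ∈ qIndexSet F, fourierCoeff g ν = (zg ν : ℂ))
    (hmaj : ∀ y : (F →+* ℝ) → ℝ, (∀ σ', 0 < y σ') →
      Summable (fun ν : {ν : F | ∀ b : 𝓞 F, ∃ n : ℤ, Algebra.trace ℚ F (ν * b) = n} ↦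
        (∑ μ ∈ (stub_finite_qIndex_antidiagonal F (ν : F)).toFinset,
            (|(zf μ.1 : ℝ)| * |(zg μ.2 : ℝ)| + |(zg μ.1 : ℝ)| * |(zf μ.2 : ℝ)|)) *
          Real.exp (-(2 * Real.pi * ∑ σ' : F →+* ℝ, σ' (ν : F) * y σ'))))
    (G : Point F → ℂ)
    (hG : ∀ ν ∈ qIndexSet F, ∀ T : Finset (F × F),
      (∀ μ : F × F, μ ∈ T ↔ μ.1 ∈ qIndexSet F ∧ μ.2 ∈ qIndexSet F ∧ μ.1 + μ.2 = ν) →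
      fourierCoeff G ν = ∑ μ ∈ T, ((σ ((NumberField.discr F : F) * μ.2) : ℝ) : ℂ) *
        ((k σ : ℂ) * (zf μ.1 : ℂ) * (zg μ.2 : ℂ) - (l σ : ℂ) * (zg μ.1 : ℂ) * (zf μ.2 : ℂ))) :
    ∃ qG : F → E, (∀ ν ∈ qIndexSet F, fourierCoeff G ν = τ (qG ν)) ∧ (∀ ν, IsIntegral ℤ (qG ν)) ∧
      ∀ (τ' : E →+* ℂ) (y : (F →+* ℝ) → ℝ), (∀ σ', 0 < y σ') →
        Summable (fun ν : {ν : F | ∀ b : 𝓞 F, ∃ n : ℤ, Algebra.trace ℚ F (ν * b) = n} ↦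
          ‖τ' (qG ν)‖ * Real.exp (-(2 * Real.pi * ∑ σ' : F →+* ℝ, σ' (ν : F) * y σ'))) := by
  refine ⟨fun ν ↦ ι (∑ μ ∈ (stub_finite_qIndex_antidiagonal F ν).toFinset,
    ((NumberField.discr F : F) * μ.2) *
      ((k σ : F) * (zf μ.1 : F) * (zg μ.2 : F) - (l σ : F) * (zg μ.1 : F) * (zf μ.2 : F))),
    fun ν hν ↦ ?_, fun ν ↦ ?_, fun τ' y hy ↦ ?_⟩
  · -- (a) the coefficient identity: push `φ = σ : F → ℝ ⊆ ℂ` through the finite sum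
    set φ : F →+* ℂ := Complex.ofRealHom.comp σ
    have hφ : ∀ t : F, ((σ t : ℝ) : ℂ) = φ t := fun t ↦ rfl
    dsimp only
    rw [hG ν hν _ (fun μ ↦ (stub_finite_qIndex_antidiagonal F ν).mem_toFinset), hι, hφ, map_sum]
    simp only [hφ]
    simp only [map_mul, map_sub, map_intCast]
  · -- (b) integrality: `x_ν ∈ 𝓞 F` and ring homomorphisms preserve integrality
    dsimp only
    exact map_isIntegral_int ι (IsIntegral.sum _ fun μ hμ ↦ bed_term_isIntegral F _ _ _ _
      ((stub_finite_qIndex_antidiagonal F ν).mem_toFinset.1 hμ).2.1)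
  · -- (c) tube summability of every conjugate: `τ' ∘ ι` is a real embedding `ρ`
    obtain ⟨ρ, hρ⟩ : ∃ ρ : F →+* ℝ, ∀ t : F, ‖τ' (ι t)‖ = |ρ t| := by
      have hreal := NumberField.IsTotallyReal.complexEmbedding_isReal (τ'.comp ι)
      refine ⟨hreal.embedding, fun t ↦ ?_⟩
      rw [← Real.norm_eq_abs, ← Complex.norm_real, hreal.coe_embedding_apply, RingHom.comp_apply]
    have hy2 : ∀ σ', 0 < y σ' / 2 := fun σ' ↦ half_pos (hy σ')
    refine ((hmaj (fun σ' ↦ y σ' / 2) hy2).mul_left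
      (|(NumberField.discr F : ℝ)| * (|(k σ : ℝ)| + |(l σ : ℝ)|) * (Real.pi * y ρ)⁻¹)).of_nonneg_of_le
      (fun ν ↦ mul_nonneg (norm_nonneg _) (Real.exp_pos _).le) (fun ν ↦ ?_)
    dsimp only
    rw [hρ]
    exact bed_coeff_weighted_le ρ (k σ) (l σ) zf zg y hy (ν : F)

end Summit.Langlands.Langlands.Theorems.HilbertIntegralOverconvergentIsCongruence

end
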